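import Literature.NumberTheory.ModularForms.LogLambda
import Literature.NumberTheory.ModularForms.QuasimodularPhi
import Literature.NumberTheory.EllipticCurves.ModularFormsRamanujan
import Mathlib.NumberTheory.ModularForms.QExpansion
import Mathlib.NumberTheory.ArithmeticFunction.Misc
import HarnessLib

/-!
# First-order `q`-asymptotics at `i∞` of `E₂, E₄, E₆, Δ, j` and the growth of `φⱼ` (CKMRV §2.1, §4.4)

Cohn–Kumar–Miller–Radchenko–Viazovska, Ann. of Math. 196 (2022) = arXiv:1902.05438, §2.1.1:
(2.3) `E₂ = 1 − 24q − 72q² − ⋯`, (2.1) `E₄ = 1 + 240q + ⋯`, `E₆ = 1 − 504q − ⋯`, `Δ = q − 24q² + ⋯`,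
`j = q⁻¹ + 744 + ⋯`.

This file records FIRST-ORDER consequences as `IsBigO` statements along `atImInfty`, with the
comparison function `expDecay τ = e^{−2π Im τ} = |q|`; everything below is proved:

* `E₄ − 1`, `E₆ − 1`, `E₂ − 1`, `Δ` are `O(e^{−2πy})` (`E₄_sub_one_isBigO`, `E₆_sub_one_isBigO`,
  `E2_sub_one_isBigO`, `discriminant_isBigO`; from Mathlib's `exp_decay_sub_atImInfty` and the
  limits at `i∞`), and `e^{−2πy} = O(Δ)` (`expDecay_isBigO_discriminant`);
* for fixed `z`: the orbit `SL₂(ℤ)·z` has bounded height (`im_smul_le`), so `j(τ) ≠ j(z)` near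
  `i∞` (`eventually_kleinJ_ne`), `(j(τ) − j(z))⁻¹ = O(e^{−2πy})` (`inv_kleinJ_sub_isBigO`) and
  `(E₄²E₆/Δ)(τ)/(j(τ) − j(z)) − 1 = O(e^{−2πy})` (`f2_div_sub_one_isBigO`);
* `φ₋₂, φ₀, φ₂ = O(|τ|)` and `φ₋₂ − 2φ₀ + φ₂ = τ(1 − E₂)² + (6i/π)(1 − E₂) = O(|τ|e^{−2πy})`
  (`phi_alt_sum_isBigO`) — the cancellation behind the bound (4.14) for `𝒦₊^{(8)}`.

The half-order comparison function `expDecayHalf τ = e^{−π Im τ} = |q^{1/2}|` is only introduced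
here (with `expDecay = expDecayHalf²` and its limit); the `q^{1/2}`-asymptotics of `U, V, W, λ, 𝓛`
((2.8)–(2.10)) are treated in a separate file.

## References

* H. Cohn, A. Kumar, S. D. Miller, D. Radchenko, M. Viazovska, Ann. of Math. 196 (2022),
  arXiv:1902.05438, §2.1.1 (2.1), (2.3); §4.4 (4.14). [CohnEtAl2019]
-/

noncomputable section

open Complex hiding I
open Filter Topology Asymptotics ModularForm SlashInvariantForm EisensteinSeries
open UpperHalfPlane hiding I
open Complex (I)
open scoped Real MatrixGroups ModularForm Manifold

namespace Literature.NumberTheory.ModularForms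

open Literature.NumberTheory.EllipticCurves.ModularForms (kleinJ kleinJ_smul kleinJ_eq_kleinJ_iff
  tendsto_E2_atImInfty periodic_E2_comp_ofComplex E₄_cube_eq_kleinJ_mul)

/-! ## The comparison functions -/

/-- `|q| = e^{−2π Im τ}`. [folklore] -/
def expDecay (τ : ℍ) : ℝ := Real.exp (-2 * π * τ.im)

/-- `|q^{1/2}| = e^{−π Im τ}`. [folklore] -/
def expDecayHalf (τ : ℍ) : ℝ := Real.exp (-π * τ.im)

/-- `0 < e^{−2πy}`. [folklore] -/
theorem expDecay_pos (τ : ℍ) : 0 < expDecay τ := Real.exp_pos _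
/-- `0 < e^{−πy}`. [folklore] -/
theorem expDecayHalf_pos (τ : ℍ) : 0 < expDecayHalf τ := Real.exp_pos _

/-- `e^{−2πy} = (e^{−πy})²`. [folklore] -/
theorem expDecay_eq_sq (τ : ℍ) : expDecay τ = expDecayHalf τ ^ 2 := by
  rw [expDecay, expDecayHalf, ← Real.exp_nat_mul]; congr 1; push_cast; ring

/-- `e^{−2πy} = O(e^{−πy})`. [folklore] -/
theorem expDecay_isBigO_expDecayHalf : expDecay =O[atImInfty] expDecayHalf := by
  refine IsBigO.of_bound 1 ?_
  rw [Filter.Eventually, atImInfty_mem]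
  refine ⟨0, fun τ _ => ?_⟩
  simp only [Set.mem_setOf_eq, Real.norm_eq_abs, abs_of_pos (expDecayHalf_pos τ), one_mul, expDecay_eq_sq, sq]
  rw [abs_of_pos (mul_pos (expDecayHalf_pos τ) (expDecayHalf_pos τ))]
  refine mul_le_of_le_one_left (expDecayHalf_pos τ).le ?_
  rw [expDecayHalf, Real.exp_le_one_iff]
  nlinarith [Real.pi_pos, τ.im_pos]

/-! ## Level-one modular forms: `f − f(i∞) = O(q)` -/

/-- `e^{−2πy} → 0` along `atImInfty`. [folklore] -/
theorem tendsto_expDecay : Tendsto expDecay atImInfty (𝓝 0) := by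
  have him : Tendsto UpperHalfPlane.im atImInfty atTop := by rw [atImInfty]; exact tendsto_comap
  have h1 : Tendsto (fun τ : ℍ => -2 * π * τ.im) atImInfty atBot :=
    him.const_mul_atTop_of_neg (by nlinarith [Real.pi_pos])
  exact Real.tendsto_exp_atBot.comp h1

/-- `e^{−πy} → 0` along `atImInfty`. [folklore] -/
theorem tendsto_expDecayHalf : Tendsto expDecayHalf atImInfty (𝓝 0) := by
  have him : Tendsto UpperHalfPlane.im atImInfty atTop := by rw [atImInfty]; exact tendsto_comap
  have h1 : Tendsto (fun τ : ℍ => -π * τ.im) atImInfty atBot :=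
    him.const_mul_atTop_of_neg (by nlinarith [Real.pi_pos])
  exact Real.tendsto_exp_atBot.comp h1

/-- A holomorphic, `1`-periodic function bounded at `i∞` with limit `v` there satisfies
`f − v = O(e^{−2πy})`. [folklore] -/
theorem sub_isBigO_of_periodic {f : ℍ → ℂ} (hper : Function.Periodic (f ∘ ofComplex) (1 : ℝ))
    (hhol : MDiff f) (hbdd : IsBoundedAtImInfty f) {v : ℂ} (hv : Tendsto f atImInfty (𝓝 v)) :
    (fun τ => f τ - v) =O[atImInfty] expDecay := by
  have h := exp_decay_sub_atImInfty (f := f) one_pos hper hhol hbdd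
  have h' : (fun τ => f τ - valueAtInfty f) =O[atImInfty] expDecay :=
    h.trans (by
      refine (isBigO_refl _ _).congr_left fun τ => ?_
      simp [expDecay])
  have hval : valueAtInfty f = v := by
    have h0 : Tendsto (fun τ => f τ - valueAtInfty f) atImInfty (𝓝 0) := h'.trans_tendsto tendsto_expDecay
    have h1 : Tendsto f atImInfty (𝓝 (0 + valueAtInfty f)) := by
      have := h0.add_const (valueAtInfty f)
      simpa using this
    rw [zero_add] at h1
    exact tendsto_nhds_unique h1 hv
  rwa [hval] at h'

/-- A level-one modular form minus its value at `i∞` is `O(e^{−2πy})`. [folklore] -/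
theorem levelOne_sub_isBigO {k : ℤ} (f : ModularForm 𝒮ℒ k) {v : ℂ} (hv : Tendsto f atImInfty (𝓝 v)) :
    (fun τ => f τ - v) =O[atImInfty] expDecay := by
  have hper : Function.Periodic (⇑f ∘ ofComplex) (1 : ℝ) :=
    SlashInvariantFormClass.periodic_comp_ofComplex f one_mem_strictPeriods_SL
  have hbdd : IsBoundedAtImInfty ⇑f := ModularFormClass.bdd_at_infty f
  exact sub_isBigO_of_periodic hper f.holo' hbdd hv

/-- **`E₄ − 1 = O(q)`, `E₆ − 1 = O(q)`** (CKMRV (2.1)). [cite: CohnEtAl2019, §2.1.1 (2.1)] -/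
theorem E₄_sub_one_isBigO : (fun τ : ℍ => E₄ τ - 1) =O[atImInfty] expDecay :=
  levelOne_sub_isBigO E₄ (ModularForm.tendsto_E_atImInfty (by norm_num) ⟨2, rfl⟩)

/-- `E₆ − 1 = O(q)`. [cite: CohnEtAl2019, §2.1.1 (2.1)] -/
theorem E₆_sub_one_isBigO : (fun τ : ℍ => E₆ τ - 1) =O[atImInfty] expDecay :=
  levelOne_sub_isBigO E₆ (ModularForm.tendsto_E_atImInfty (by norm_num) ⟨3, rfl⟩)

/-- **`Δ = O(q)`**. [cite: CohnEtAl2019, §2.1.1 (2.1)] -/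
theorem discriminant_isBigO : (ModularForm.discriminant : ℍ → ℂ) =O[atImInfty] expDecay := by
  have h := levelOne_sub_isBigO (CuspForm.discriminant : ModularForm 𝒮ℒ 12)
    (v := 0) ?_
  · refine h.congr_left fun τ => ?_
    simp
  · exact CuspFormClass.zero_at_infty CuspForm.discriminant

/-- **`E₂ − 1 = O(q)`** (CKMRV (2.3): `E₂ = 1 − 24q − ⋯`). [cite: CohnEtAl2019, §2.1.1 (2.3)] -/
theorem E2_sub_one_isBigO : (fun τ : ℍ => E2 τ - 1) =O[atImInfty] expDecay :=
  sub_isBigO_of_periodic periodic_E2_comp_ofComplex E2_mdifferentiable EisensteinSeries.isBoundedAtImInfty_E2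
    tendsto_E2_atImInfty

/-- **`q = O(Δ)`**: `e^{−2πy} ≤ 2|Δ(τ)|` near `i∞` (`Δe^{−2πiτ} → 1`). [cite: CohnEtAl2019, §2.1.1 (2.1)] -/
theorem expDecay_isBigO_discriminant : (fun τ => (expDecay τ : ℝ)) =O[atImInfty] (ModularForm.discriminant : ℍ → ℂ) := by
  have h := tendsto_exp_mul_discriminant
  have hev : ∀ᶠ τ : ℍ in atImInfty, 1 / 2 ≤ ‖cexp (-(2 * π * I * τ)) * ModularForm.discriminant τ‖ := by
    have := (continuous_norm.tendsto (1 : ℂ)).comp h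
    rw [norm_one] at this
    exact this.eventually (eventually_ge_nhds (by norm_num : (1 / 2 : ℝ) < 1)) |>.mono fun τ hτ => hτ
  refine IsBigO.of_bound 2 ?_
  filter_upwards [hev] with τ hτ
  rw [norm_mul, Complex.norm_exp] at hτ
  have hre : (-(2 * π * I * (τ : ℂ))).re = 2 * π * τ.im := by
    simp [Complex.mul_re, UpperHalfPlane.coe_im, UpperHalfPlane.coe_re]
  rw [hre] at hτ
  rw [Real.norm_eq_abs, abs_of_pos (expDecay_pos τ), expDecay]
  have hpos : 0 < Real.exp (2 * π * τ.im) := Real.exp_pos _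
  have hprod : Real.exp (-2 * π * τ.im) * Real.exp (2 * π * τ.im) = 1 := by
    rw [← Real.exp_add]; simp
  nlinarith [norm_nonneg (ModularForm.discriminant τ)]

/-- **`(j(τ) − j(z))⁻¹ = O(q)`** for fixed `z` (`j(τ) − j(z) = (E₄³ − j(z)Δ)/Δ` with
`E₄³ − j(z)Δ → 1`). [cite: CohnEtAl2019, §2.1.1 (2.1)] -/
theorem inv_kleinJ_sub_isBigO (z : ℍ) : (fun τ => (kleinJ τ - kleinJ z)⁻¹) =O[atImInfty] expDecay := by
  -- `E₄³ − j(z)Δ → 1`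
  have hE4 : Tendsto (⇑E₄) atImInfty (𝓝 1) := ModularForm.tendsto_E_atImInfty (by norm_num) ⟨2, rfl⟩
  have hΔ0 : Tendsto (ModularForm.discriminant : ℍ → ℂ) atImInfty (𝓝 0) := CuspFormClass.zero_at_infty CuspForm.discriminant
  have hden : Tendsto (fun τ => E₄ τ ^ 3 - kleinJ z * ModularForm.discriminant τ) atImInfty (𝓝 1) := by
    have := (hE4.pow 3).sub (hΔ0.const_mul (kleinJ z))
    simpa using this
  have hev : ∀ᶠ τ : ℍ in atImInfty, 1 / 2 ≤ ‖E₄ τ ^ 3 - kleinJ z * ModularForm.discriminant τ‖ := by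
    have := (continuous_norm.tendsto (1 : ℂ)).comp hden
    rw [norm_one] at this
    exact this.eventually (eventually_ge_nhds (by norm_num : (1 / 2 : ℝ) < 1))
  -- `(j − j(z))⁻¹ = Δ/(E₄³ − j(z)Δ)`
  have hform : ∀ τ : ℍ, E₄ τ ^ 3 - kleinJ z * ModularForm.discriminant τ ≠ 0 →
      (kleinJ τ - kleinJ z)⁻¹ = ModularForm.discriminant τ / (E₄ τ ^ 3 - kleinJ z * ModularForm.discriminant τ) := by
    intro τ hne
    have hΔ := ModularForm.discriminant_ne_zero τ
    have hj : kleinJ τ = E₄ τ ^ 3 / ModularForm.discriminant τ := by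
      rw [eq_div_iff hΔ]; exact (E₄_cube_eq_kleinJ_mul τ).symm
    rw [hj, inv_eq_one_div, div_sub' hΔ, one_div_div, mul_comm (ModularForm.discriminant τ) (kleinJ z)]
  have h1 : (fun τ => (kleinJ τ - kleinJ z)⁻¹) =O[atImInfty] (ModularForm.discriminant : ℍ → ℂ) := by
    refine IsBigO.of_bound 2 ?_
    filter_upwards [hev] with τ hτ
    have hne : E₄ τ ^ 3 - kleinJ z * ModularForm.discriminant τ ≠ 0 := fun h0 => by
      rw [h0, norm_zero] at hτ; norm_num at hτ
    rw [hform τ hne, norm_div, div_le_iff₀ (by linarith)]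
    nlinarith [norm_nonneg (ModularForm.discriminant τ)]
  exact h1.trans discriminant_isBigO

/-- The orbit `SL₂(ℤ)·z` has bounded height: `Im(γz) ≤ max (Im z) (Im z)⁻¹`. [folklore] -/
theorem im_smul_le (γ : SL(2, ℤ)) (z : ℍ) : (γ • z).im ≤ max z.im z.im⁻¹ := by
  rw [ModularGroup.im_smul_eq_div_normSq]
  have hz := z.im_pos
  by_cases hc : (γ 1 0 : ℤ) = 0
  · -- `c = 0`: then `d = ±1` and `Im(γz) = Im z`
    have hdet := Matrix.SpecialLinearGroup.det_coe γ
    rw [Matrix.det_fin_two, hc, mul_zero, sub_zero] at hdet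
    have hd : (γ 1 1 : ℤ) = 1 ∨ (γ 1 1 : ℤ) = -1 := by
      rcases Int.eq_one_or_neg_one_of_mul_eq_one' hdet with ⟨_, h⟩ | ⟨_, h⟩
      · exact Or.inl h
      · exact Or.inr h
    have hnorm : Complex.normSq (denom (γ : GL (Fin 2) ℝ) z) = 1 := by
      rw [ModularGroup.denom_apply, hc]
      rcases hd with h | h <;> simp [h, Complex.normSq]
    rw [hnorm, div_one]
    exact le_max_left _ _
  · -- `c ≠ 0`: `|cz + d|² ≥ c²(Im z)² ≥ (Im z)²`
    have hc1 : (1 : ℝ) ≤ ((γ 1 0 : ℤ) : ℝ) ^ 2 := by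
      have : (1 : ℤ) ≤ (γ 1 0 : ℤ) ^ 2 := by
        rcases lt_or_gt_of_ne hc with h | h <;> nlinarith
      exact_mod_cast this
    have hns : z.im ^ 2 ≤ Complex.normSq (denom (γ : GL (Fin 2) ℝ) z) := by
      rw [ModularGroup.denom_apply, Complex.normSq_apply]
      simp only [Complex.add_re, Complex.mul_re, Complex.intCast_re, Complex.intCast_im, zero_mul, sub_zero,
        Complex.add_im, Complex.mul_im, add_zero, UpperHalfPlane.coe_im, UpperHalfPlane.coe_re]
      nlinarith [sq_nonneg (((γ 1 0 : ℤ) : ℝ) * z.re + ((γ 1 1 : ℤ) : ℝ)), sq_nonneg z.im,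
        mul_le_mul_of_nonneg_right hc1 (sq_nonneg z.im)]
    calc z.im / Complex.normSq (denom (γ : GL (Fin 2) ℝ) z) ≤ z.im / z.im ^ 2 :=
          div_le_div_of_nonneg_left hz.le (by positivity) hns
      _ = z.im⁻¹ := by field_simp
      _ ≤ max z.im z.im⁻¹ := le_max_right _ _

/-- Near `i∞`, `j(τ) ≠ j(z)` (the orbit of `z` has bounded height). [folklore] -/
theorem eventually_kleinJ_ne (z : ℍ) : ∀ᶠ τ : ℍ in atImInfty, kleinJ τ - kleinJ z ≠ 0 := by
  rw [Filter.Eventually, atImInfty_mem]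
  refine ⟨max z.im z.im⁻¹ + 1, fun τ hτ => ?_⟩
  simp only [Set.mem_setOf_eq, sub_ne_zero]
  intro hj
  obtain ⟨γ, hγ⟩ := kleinJ_eq_kleinJ_iff.1 hj.symm
  have := im_smul_le γ z
  rw [hγ] at this
  linarith

/-- **`(E₁₄/Δ)(τ)/(j(τ) − j(z)) − 1 = O(q)`**: `E₁₄/(Δ(j − j(z))) = E₁₄/(E₄³ − j(z)Δ)` and
`E₁₄ − E₄³ + j(z)Δ = E₄²(E₆ − E₄) + j(z)Δ = O(q)`. [cite: CohnEtAl2019, §2.1.1 (2.1)–(2.2)] -/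
theorem f2_div_sub_one_isBigO (z : ℍ) :
    (fun τ => E₄ τ * E₄ τ * E₆ τ * (ModularForm.discriminant τ)⁻¹ * (kleinJ τ - kleinJ z)⁻¹ - 1)
      =O[atImInfty] expDecay := by
  have hE4 : Tendsto (⇑E₄) atImInfty (𝓝 1) := ModularForm.tendsto_E_atImInfty (by norm_num) ⟨2, rfl⟩
  have hΔ0 : Tendsto (ModularForm.discriminant : ℍ → ℂ) atImInfty (𝓝 0) := CuspFormClass.zero_at_infty CuspForm.discriminant
  have hden : Tendsto (fun τ => E₄ τ ^ 3 - kleinJ z * ModularForm.discriminant τ) atImInfty (𝓝 1) := by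
    have := (hE4.pow 3).sub (hΔ0.const_mul (kleinJ z))
    simpa using this
  have hev : ∀ᶠ τ : ℍ in atImInfty, 1 / 2 ≤ ‖E₄ τ ^ 3 - kleinJ z * ModularForm.discriminant τ‖ := by
    have := (continuous_norm.tendsto (1 : ℂ)).comp hden
    rw [norm_one] at this
    exact this.eventually (eventually_ge_nhds (by norm_num : (1 / 2 : ℝ) < 1))
  -- the numerator `E₄²(E₆ − E₄) + j(z)Δ = O(q)`
  have hnum : (fun τ => E₄ τ ^ 2 * (E₆ τ - E₄ τ) + kleinJ z * ModularForm.discriminant τ) =O[atImInfty] expDecay := by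
    have hb : (fun τ : ℍ => E₄ τ ^ 2) =O[atImInfty] (fun _ => (1 : ℝ)) := by
      have := (hE4.pow 2).isBigO_one ℝ
      simpa using this
    have h64 : (fun τ => E₆ τ - E₄ τ) =O[atImInfty] expDecay :=
      (E₆_sub_one_isBigO.sub E₄_sub_one_isBigO).congr_left fun τ => by ring
    have h1 := hb.mul h64
    simp only [one_mul] at h1
    exact h1.add (discriminant_isBigO.const_mul_left _)
  refine IsBigO.trans (IsBigO.of_bound 2 ?_) hnum
  filter_upwards [hev, eventually_kleinJ_ne z] with τ hτ hJ
  have hne : E₄ τ ^ 3 - kleinJ z * ModularForm.discriminant τ ≠ 0 := fun h0 => by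
    rw [h0, norm_zero] at hτ; norm_num at hτ
  have hΔ := ModularForm.discriminant_ne_zero τ
  have hj : kleinJ τ = E₄ τ ^ 3 / ModularForm.discriminant τ := by
    rw [eq_div_iff hΔ]; exact (E₄_cube_eq_kleinJ_mul τ).symm
  have hJ' : kleinJ τ - kleinJ z = (E₄ τ ^ 3 - kleinJ z * ModularForm.discriminant τ) / ModularForm.discriminant τ := by
    rw [hj]; field_simp
  have hform : E₄ τ * E₄ τ * E₆ τ * (ModularForm.discriminant τ)⁻¹ * (kleinJ τ - kleinJ z)⁻¹ - 1 =
      (E₄ τ ^ 2 * (E₆ τ - E₄ τ) + kleinJ z * ModularForm.discriminant τ) /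
        (E₄ τ ^ 3 - kleinJ z * ModularForm.discriminant τ) := by
    have hne' : E₄ τ ^ 3 - ModularForm.discriminant τ * kleinJ z ≠ 0 := by rwa [mul_comm] at hne
    rw [hJ', inv_div]
    field_simp
    ring
  rw [hform, norm_div, div_le_iff₀ (by linarith)]
  nlinarith [norm_nonneg (E₄ τ ^ 2 * (E₆ τ - E₄ τ) + kleinJ z * ModularForm.discriminant τ)]

/-! ## Growth of `φⱼ(τ)` : `O(|τ|)` -/

/-- Near `i∞`, `1 ≤ ‖τ‖`. [folklore] -/
theorem eventually_one_le_norm_coe : ∀ᶠ τ : ℍ in atImInfty, 1 ≤ ‖(τ : ℂ)‖ := by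
  rw [Filter.Eventually, atImInfty_mem]
  exact ⟨1, fun τ hτ => hτ.trans (im_le_norm_coe τ)⟩

/-- A function bounded at `i∞` is `O(|τ|)`. [folklore] -/
theorem isBigO_norm_coe_of_bounded {f : ℍ → ℂ} (hf : IsBoundedAtImInfty f) :
    f =O[atImInfty] fun τ : ℍ => ‖(τ : ℂ)‖ := by
  have hf' : f =O[atImInfty] (fun _ : ℍ => (1 : ℝ)) := hf
  refine hf'.trans (IsBigO.of_bound 1 ?_)
  filter_upwards [eventually_one_le_norm_coe] with τ hτ
  simpa using hτ

/-- `τ · f = O(|τ|)` for `f` bounded at `i∞`. [folklore] -/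
theorem coe_mul_isBigO_of_bounded {f : ℍ → ℂ} (hf : IsBoundedAtImInfty f) :
    (fun τ : ℍ => (τ : ℂ) * f τ) =O[atImInfty] fun τ : ℍ => ‖(τ : ℂ)‖ := by
  have hf' : f =O[atImInfty] (fun _ : ℍ => (1 : ℝ)) := hf
  have hf'' : f =O[atImInfty] (fun _ : ℍ => (1 : ℂ)) := hf'.trans_le fun _ => by simp
  have := (isBigO_refl (fun τ : ℍ => (τ : ℂ)) atImInfty).mul hf''
  refine this.trans (IsBigO.of_bound 1 (Eventually.of_forall fun τ => ?_))
  simp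

/-- `φ₋₂(τ) = τ = O(|τ|)`. [folklore] -/
theorem phiNeg2_isBigO : phiNeg2 =O[atImInfty] fun τ : ℍ => ‖(τ : ℂ)‖ :=
  IsBigO.of_bound 1 (Eventually.of_forall fun τ => by simp [phiNeg2])

/-- `φ₀(τ) = τE₂ − 3i/π = O(|τ|)`. [cite: CohnEtAl2019, §4.2] -/
theorem phi0_isBigO : phi0 =O[atImInfty] fun τ : ℍ => ‖(τ : ℂ)‖ := by
  have h1 := coe_mul_isBigO_of_bounded EisensteinSeries.isBoundedAtImInfty_E2
  have h2 : (fun _ : ℍ => (3 * I / π : ℂ)) =O[atImInfty] fun τ : ℍ => ‖(τ : ℂ)‖ :=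
    isBigO_norm_coe_of_bounded (Filter.const_boundedAtFilter atImInfty (3 * I / π : ℂ))
  exact (h1.sub h2).congr_left fun τ => by simp [phi0]

/-- `φ₂(τ) = τE₂² − 6iE₂/π = O(|τ|)`. [cite: CohnEtAl2019, §4.2] -/
theorem phi2_isBigO : phi2 =O[atImInfty] fun τ : ℍ => ‖(τ : ℂ)‖ := by
  have hE := EisensteinSeries.isBoundedAtImInfty_E2
  obtain ⟨M, A, hM⟩ := isBoundedAtImInfty_iff.1 hE
  have hE2 : IsBoundedAtImInfty (fun τ => E2 τ ^ 2) :=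
    isBoundedAtImInfty_iff.2 ⟨M ^ 2, A, fun τ hτ => by
      rw [norm_pow]; exact pow_le_pow_left₀ (norm_nonneg _) (hM τ hτ) 2⟩
  have h1 := coe_mul_isBigO_of_bounded hE2
  have h2 : (fun τ : ℍ => (6 * I / π : ℂ) * E2 τ) =O[atImInfty] fun τ : ℍ => ‖(τ : ℂ)‖ :=
    isBigO_norm_coe_of_bounded (hE.const_mul_left (6 * I / π))
  exact (h1.sub h2).congr_left fun τ => by simp [phi2]

/-- `e^{−2πy} ≤ 1` on `ℍ`: `q = O(1)`. [folklore] -/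
theorem expDecay_le_one (τ : ℍ) : expDecay τ ≤ 1 := by
  rw [expDecay, Real.exp_le_one_iff]; nlinarith [Real.pi_pos, τ.im_pos]

/-- **`φ₋₂ − 2φ₀ + φ₂ = τ(1 − E₂)² + (6i/π)(1 − E₂) = O(|τ|q)`**. [cite: CohnEtAl2019, §4.4 (4.14)] -/
theorem phi_alt_sum_isBigO :
    (fun τ => phiNeg2 τ - 2 * phi0 τ + phi2 τ) =O[atImInfty] fun τ : ℍ => ‖(τ : ℂ)‖ * expDecay τ := by
  have hE := E2_sub_one_isBigO
  obtain ⟨C, hC⟩ := hE.bound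
  -- `τ(1 − E₂)² = O(|τ| q)` : `‖E₂ − 1‖ ≤ C q ≤ C`
  have h1 : (fun τ : ℍ => (τ : ℂ) * (E2 τ - 1) ^ 2) =O[atImInfty] fun τ : ℍ => ‖(τ : ℂ)‖ * expDecay τ := by
    refine IsBigO.of_bound (C * C) ?_
    filter_upwards [hC] with τ hτ
    rw [Real.norm_eq_abs, abs_of_pos (expDecay_pos τ)] at hτ
    rw [norm_mul, norm_pow, Real.norm_eq_abs, abs_of_pos (mul_pos ?_ (expDecay_pos τ))]
    · have hq := expDecay_le_one τ
      have hE0 : 0 ≤ ‖E2 τ - 1‖ := norm_nonneg _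
      have hC0 : 0 ≤ C * expDecay τ := hE0.trans hτ
      have : ‖E2 τ - 1‖ ^ 2 ≤ C * C * expDecay τ := by
        calc ‖E2 τ - 1‖ ^ 2 ≤ (C * expDecay τ) ^ 2 := pow_le_pow_left₀ hE0 hτ 2
          _ = C * C * expDecay τ * expDecay τ := by ring
          _ ≤ C * C * expDecay τ * 1 := mul_le_mul_of_nonneg_left hq (by nlinarith [expDecay_pos τ])
          _ = C * C * expDecay τ := mul_one _
      calc ‖(τ : ℂ)‖ * ‖E2 τ - 1‖ ^ 2 ≤ ‖(τ : ℂ)‖ * (C * C * expDecay τ) :=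
            mul_le_mul_of_nonneg_left this (norm_nonneg _)
        _ = C * C * (‖(τ : ℂ)‖ * expDecay τ) := by ring
    · exact norm_pos_iff.2 (UpperHalfPlane.ne_zero τ)
  -- `(6i/π)(1 − E₂) = O(q) = O(|τ| q)`
  have h2 : (fun τ : ℍ => (6 * I / π : ℂ) * (E2 τ - 1)) =O[atImInfty] fun τ : ℍ => ‖(τ : ℂ)‖ * expDecay τ := by
    refine (hE.const_mul_left _).trans (IsBigO.of_bound 1 ?_)
    filter_upwards [eventually_one_le_norm_coe] with τ hτ
    rw [Real.norm_eq_abs, abs_of_pos (expDecay_pos τ), Real.norm_eq_abs, one_mul,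
      abs_of_pos (mul_pos (by linarith) (expDecay_pos τ))]
    nlinarith [expDecay_pos τ]
  exact (h1.sub h2).congr_left fun τ => by simp only [phiNeg2, phi0, phi2]; ring

end Literature.NumberTheory.ModularForms
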